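import Literature.Analysis.Matrix.MotzkinWasow
import HarnessLib

/-!
# The Motzkin–Wasow lemma in matrix form (Gilbarg–Trudinger, Lemma 17.13)

The linear-algebra input of the Evans–Krylov theorem (Gilbarg–Trudinger Thm. 17.14), a brick of
GT Thm. 17.14 for `Literature.Geometry.Riemannian.gurskyViaclovsky_pathClosed_weighted_four`;
everything here is proved.

* `exists_motzkinWasow_directions` — **GT Lemma 17.13**: for `0 < λ ≤ Λ` and any prescribed
  finite family `extra` of unit vectors there are finitely many unit vectors `γ₁, …, γ_N`
  (among them the prescribed ones) and constants `0 < λ* ≤ Λ*`, depending only on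
  `n, λ, Λ, extra`, such that every symmetric `A` with `λ|ξ|² ≤ ξᵀAξ ≤ Λ|ξ|²` is
  `A = Σ_k β_k γ_k ⊗ γ_k` with `λ* ≤ β_k ≤ Λ*`.
  It is obtained from the pairing form
  `Literature.Analysis.Matrix.MotzkinWasow.motzkinWasow_pairing` (applied to the class
  `S[λ/2, Λ]`) by testing the pairing against the elementary matrices
  (`eq_sum_smul_vecMulVec_of_pairing`), absorbing the prescribed directions through the shift
  `A − ε Σ_k extra_k ⊗ extra_k ∈ S[λ/2, Λ]`, `ε = λ/(2M+2)` (the last paragraph of GT's proof),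
  and enumerating the finite index type by `Fin N`.
* `entry_eq_half_diag_sub`, `diag_entry_eq` — polarization: the entries of a symmetric matrix
  are read off from its quadratic form along the Evans–Krylov directions `e_i`, `(e_i ± e_j)/√2`
  (GT §17.4, p. 458: the pure second derivatives along the `γ_k` control all mixed ones).

## References

* D. Gilbarg, N. S. Trudinger, *Elliptic Partial Differential Equations of Second Order* (2001),
  Lemma 17.13 and §17.4. [GilbargTrudinger2001]
-/

noncomputable section

open Matrix Finset

namespace Literature.Analysis.PDE.EvansKrylov

open Literature.Analysis.Matrix.MotzkinWasow

variable {ι : Type*} [Fintype ι] [DecidableEq ι]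

/-- Testing the pairing `Σ_{ij} B_ij h_ij` against the elementary matrix `h = E_{ab}` returns
the entry `B_ab`. [folklore] -/
theorem pairing_single (B : Matrix ι ι ℝ) (a b : ι) :
    ∑ i, ∑ j, B i j * Matrix.single a b (1 : ℝ) i j = B a b := by
  have h : ∀ i j, B i j * Matrix.single a b (1 : ℝ) i j =
      if b = j then (if a = i then B i j else 0) else 0 := by
    intro i j
    by_cases hj : b = j
    · by_cases hi : a = i
      · subst hi; subst hj; simp
      · rw [Matrix.single_apply_of_ne (h := fun hh ↦ hi hh.1), if_pos hj, if_neg hi, mul_zero]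
    · rw [Matrix.single_apply_of_ne (h := fun hh ↦ hj hh.2), if_neg hj, mul_zero]
  simp only [h, Finset.sum_ite_eq, Finset.mem_univ, if_true]

/-- **From the pairing form to the matrix identity**: if `Σ_{ij} A_ij h_ij = Σ_k β_k (γ_k · hγ_k)`
for every test matrix `h`, then `A = Σ_k β_k γ_k ⊗ γ_k`. [folklore] -/
theorem eq_sum_smul_vecMulVec_of_pairing {K : Type*} [Fintype K] {A : Matrix ι ι ℝ}
    {β : K → ℝ} {γ : K → ι → ℝ}
    (h : ∀ h : Matrix ι ι ℝ, ∑ i, ∑ j, A i j * h i j = ∑ k, β k * (γ k ⬝ᵥ (h *ᵥ γ k))) :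
    A = ∑ k, β k • vecMulVec (γ k) (γ k) := by
  ext a b
  rw [← pairing_single A a b, h, Matrix.sum_apply]
  refine Finset.sum_congr rfl fun k _ ↦ ?_
  rw [Matrix.smul_apply, smul_eq_mul, ← pairing_vecMulVec, pairing_single]

omit [DecidableEq ι] in
/-- Quadratic form of a finite sum of dyads of unit vectors:
`0 ≤ ξᵀ(Σ_k u_k ⊗ u_k)ξ ≤ (#K)|ξ|²` (Cauchy–Schwarz). [folklore] -/
theorem dotProduct_sum_vecMulVec_mulVec_bounds {K : Type*} [Fintype K] {u : K → ι → ℝ}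
    (hu : ∀ k, u k ⬝ᵥ u k = 1) (ξ : ι → ℝ) :
    0 ≤ ξ ⬝ᵥ ((∑ k, vecMulVec (u k) (u k)) *ᵥ ξ) ∧
      ξ ⬝ᵥ ((∑ k, vecMulVec (u k) (u k)) *ᵥ ξ) ≤ Fintype.card K * (ξ ⬝ᵥ ξ) := by
  have hq : ξ ⬝ᵥ ((∑ k, vecMulVec (u k) (u k)) *ᵥ ξ) = ∑ k, (u k ⬝ᵥ ξ) ^ 2 := by
    rw [Matrix.sum_mulVec, dotProduct_sum]
    exact Finset.sum_congr rfl fun k _ ↦ dotProduct_vecMulVec_mulVec _ _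
  rw [hq]
  refine ⟨Finset.sum_nonneg fun k _ ↦ sq_nonneg _, ?_⟩
  calc ∑ k, (u k ⬝ᵥ ξ) ^ 2 ≤ ∑ _k : K, ξ ⬝ᵥ ξ :=
        Finset.sum_le_sum fun k _ ↦ sq_dotProduct_le_of_unit (hu k) ξ
    _ = Fintype.card K * (ξ ⬝ᵥ ξ) := by rw [sum_const, nsmul_eq_mul, Finset.card_univ]

/-- **Motzkin–Wasow / Gilbarg–Trudinger Lemma 17.13.** For `0 < λ ≤ Λ` and any prescribed
finite family of unit vectors `extra`, there are finitely many unit vectors `γ₁, …, γ_N`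
(containing the prescribed ones) and `0 < λ* ≤ Λ*` such that every symmetric matrix `A` with
`λ|ξ|² ≤ ξᵀAξ ≤ Λ|ξ|²` is `A = Σ_k β_k γ_k ⊗ γ_k` with `λ* ≤ β_k ≤ Λ*`.
[cite: GilbargTrudinger2001, Lemma 17.13] -/
theorem exists_motzkinWasow_directions (ι : Type*) [Fintype ι] [DecidableEq ι] [Nonempty ι]
    {lam Λ : ℝ} (hlam : 0 < lam) (hΛ : lam ≤ Λ) {M : ℕ} (extra : Fin M → ι → ℝ)
    (hextra : ∀ k, extra k ⬝ᵥ extra k = 1) :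
    ∃ (N : ℕ) (γ : Fin N → ι → ℝ) (lamS ΛS : ℝ), 0 < lamS ∧ lamS ≤ ΛS ∧
      (∀ k, γ k ⬝ᵥ γ k = 1) ∧ (∀ k : Fin M, ∃ j : Fin N, γ j = extra k) ∧
      ∀ A : Matrix ι ι ℝ, A.IsSymm →
        (∀ ξ : ι → ℝ, lam * (ξ ⬝ᵥ ξ) ≤ ξ ⬝ᵥ (A *ᵥ ξ)) →
        (∀ ξ : ι → ℝ, ξ ⬝ᵥ (A *ᵥ ξ) ≤ Λ * (ξ ⬝ᵥ ξ)) →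
        ∃ β : Fin N → ℝ, (∀ k, lamS ≤ β k ∧ β k ≤ ΛS) ∧
          A = ∑ k, β k • vecMulVec (γ k) (γ k) := by
  classical
  -- the Motzkin–Wasow family of the class `S[λ/2, Λ]`
  obtain ⟨t, lam₀, Lam₀, -, ht, hlam₀, hle₀, hrep⟩ :=
    motzkinWasow_pairing (n := ι) (lam := lam / 2) (Lam := Λ) (half_pos hlam) (by linarith)
  -- the directions: the Motzkin–Wasow ones and the prescribed ones
  set γ : (↥t × (ι ⊕ OffDiag ι ⊕ OffDiag ι)) ⊕ Fin M → ι → ℝ :=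
    Sum.elim (fun k ↦ dir (k.1 : Matrix ι ι ℝ) k.2) extra with hγ
  have hγu : ∀ k, γ k ⬝ᵥ γ k = 1 := by
    rintro (k | k)
    · exact dir_unit (ht _ k.1.2) k.2
    · exact hextra k
  set ε : ℝ := lam / (2 * M + 2) with hε
  have hε0 : 0 < ε := div_pos hlam (by positivity)
  have hεM : ε * M ≤ lam / 2 := by
    rw [hε, div_mul_eq_mul_div, div_le_div_iff₀ (by positivity) (by norm_num : (0:ℝ) < 2)]
    nlinarith [hlam.le]
  -- enumeration of the index type
  set e := Fintype.equivFin ((↥t × (ι ⊕ OffDiag ι ⊕ OffDiag ι)) ⊕ Fin M) with he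
  refine ⟨_, fun j ↦ γ (e.symm j), min lam₀ ε, max Lam₀ ε, lt_min hlam₀ hε0,
    (min_le_left _ _).trans (hle₀.trans (le_max_left _ _)), fun j ↦ hγu _,
    fun k ↦ ⟨e (Sum.inr k), by simp only [Equiv.symm_apply_apply, hγ, Sum.elim_inr]⟩, ?_⟩
  intro A hA hlow hup
  -- the shift `A' = A − ε Σ_k extra_k ⊗ extra_k` lies in `S[λ/2, Λ]`
  set P : Matrix ι ι ℝ := ∑ k : Fin M, vecMulVec (extra k) (extra k) with hP
  set A' : Matrix ι ι ℝ := A - ε • P with hA'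
  have hPs : P.IsSymm := by
    rw [Matrix.IsSymm, hP, transpose_sum]
    exact Finset.sum_congr rfl fun k _ ↦ transpose_vecMulVec _ _
  have hA's : A'.IsSymm := by
    rw [Matrix.IsSymm, hA', transpose_sub, transpose_smul, hA.eq, hPs.eq]
  have hform : ∀ x : ι → ℝ,
      lam / 2 * (x ⬝ᵥ x) ≤ x ⬝ᵥ (A' *ᵥ x) ∧ x ⬝ᵥ (A' *ᵥ x) ≤ Λ * (x ⬝ᵥ x) := by
    intro x
    have hx : 0 ≤ x ⬝ᵥ x := Finset.sum_nonneg fun i _ ↦ mul_self_nonneg (x i)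
    have hq : x ⬝ᵥ (A' *ᵥ x) = x ⬝ᵥ (A *ᵥ x) - ε * (x ⬝ᵥ (P *ᵥ x)) := by
      rw [hA', sub_mulVec, dotProduct_sub, smul_mulVec, dotProduct_smul, smul_eq_mul]
    obtain ⟨hP0, hP1⟩ := dotProduct_sum_vecMulVec_mulVec_bounds hextra x
    rw [Fintype.card_fin] at hP1
    rw [hq]
    constructor
    · have h1 := hlow x
      have h2 : ε * (x ⬝ᵥ (P *ᵥ x)) ≤ lam / 2 * (x ⬝ᵥ x) :=
        (mul_le_mul_of_nonneg_left hP1 hε0.le).trans (by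
          rw [← mul_assoc]; exact mul_le_mul_of_nonneg_right hεM hx)
      linarith
    · have h2 := hup x
      nlinarith [hε0.le, hP0]
  obtain ⟨β₀, hβ₀, hrepA⟩ := hrep A' hA's hform
  have hA'eq : A' = ∑ k, β₀ k •
      vecMulVec (dir (k.1 : Matrix ι ι ℝ) k.2) (dir (k.1 : Matrix ι ι ℝ) k.2) :=
    eq_sum_smul_vecMulVec_of_pairing hrepA
  set β : (↥t × (ι ⊕ OffDiag ι ⊕ OffDiag ι)) ⊕ Fin M → ℝ := Sum.elim β₀ (fun _ ↦ ε) with hβ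
  have hβb : ∀ k, min lam₀ ε ≤ β k ∧ β k ≤ max Lam₀ ε := by
    rintro (k | k)
    · exact ⟨(min_le_left _ _).trans (hβ₀ k).1, (hβ₀ k).2.trans (le_max_left _ _)⟩
    · exact ⟨min_le_right _ _, le_max_right _ _⟩
  refine ⟨fun j ↦ β (e.symm j), fun j ↦ hβb _, ?_⟩
  rw [Fintype.sum_equiv e.symm _ (fun k ↦ β k • vecMulVec (γ k) (γ k)) (fun _ ↦ rfl),
    Fintype.sum_sum_type]
  simp only [hβ, hγ, Sum.elim_inl, Sum.elim_inr]
  rw [← hA'eq, ← Finset.smul_sum, ← hP, hA', sub_add_cancel]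

/-- **The Evans–Krylov direction set**: the coordinate directions `e_i` and the diagonals
`(e_i ± e_j)/√2`, `i ≠ j`, are unit vectors, and the pure second derivatives along them control
all mixed ones: `H i j = (q⁺_{ij} − q⁻_{ij})/2` with `q^±_{ij} = γ^±ᵀ H γ^±`,
`γ^± = (e_i ± e_j)/√2`, for symmetric `H`.
[cite: GilbargTrudinger2001, Lemma 17.13 (last assertion) and §17.4, p. 458] -/
theorem entry_eq_half_diag_sub (ι : Type*) [Fintype ι] [DecidableEq ι] (H : Matrix ι ι ℝ)
    (hH : H.IsSymm) {i j : ι} (hij : i ≠ j) :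
    H i j = ((((Real.sqrt 2)⁻¹ • (Pi.single i 1 + Pi.single j 1)) ⬝ᵥ
                (H *ᵥ ((Real.sqrt 2)⁻¹ • (Pi.single i 1 + Pi.single j 1)))) -
              (((Real.sqrt 2)⁻¹ • (Pi.single i 1 - Pi.single j 1)) ⬝ᵥ
                (H *ᵥ ((Real.sqrt 2)⁻¹ • (Pi.single i 1 - Pi.single j 1))))) / 2 := by
  have hs : H j i = H i j := hH.apply i j
  have h2 : (Real.sqrt 2)⁻¹ * (Real.sqrt 2)⁻¹ = 1 / 2 := by
    rw [← mul_inv, Real.mul_self_sqrt (by norm_num : (0:ℝ) ≤ 2), one_div]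
  simp only [mulVec_smul, mulVec_add, mulVec_sub, smul_dotProduct, dotProduct_smul,
    add_dotProduct, sub_dotProduct, dotProduct_add, dotProduct_sub, smul_eq_mul,
    mulVec_single_one, single_one_dotProduct, Matrix.col_apply, hs]
  have _h := hij
  linear_combination (-(2:ℝ) * H i j) * h2

/-- The diagonal entries of a matrix are its quadratic form along the coordinate directions:
`H i i = e_iᵀ H e_i`. [folklore] -/
theorem diag_entry_eq (ι : Type*) [Fintype ι] [DecidableEq ι] (H : Matrix ι ι ℝ) (i : ι) :
    H i i = (Pi.single i (1 : ℝ)) ⬝ᵥ (H *ᵥ Pi.single i 1) := by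
  rw [mulVec_single_one, single_one_dotProduct, Matrix.col_apply]

end Literature.Analysis.PDE.EvansKrylov

end
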